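import Summits.Parity.GeneralizedHardyLittlewood.Theorems.PrimeLevelFamEdgeIdeaDeltasNegationTables
import HarnessLib

/-!
# Route `PrimeLevelFamEdge` — TYPED IDEA DELTAS, deck 14e: K-L20-3 «THE ROGUE FORM», part 2 — the ROGUE EXTENSION
# `T ⊕ {f*}` (`w* = q^{-3/2}`, `λ* = μψ`, `Λ*(½) = q̂^{1/2}√q`) with its exact decomposition lemmas (§3), and the elementary
# squarefree count `N ≤ 3·#{m ≤ N : μ²(m) = 1}` (§4).  Seat ls-idea-lens-20 gen 2, `Sketch_L20c_RogueForm.lean` v10 sha16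
# 64d60d2997a1fa36 l.306–557 VERBATIM up to the namespace `.L20c` → `.Negation` (typer ls-idea-typ-1 gen 3); critic E b8
# PASS (independence certificate).  Part 1 = deck 14d (tables + dictionary + (O1)); parts 3–5 = decks 14f–h.
HONESTY: everything here is about TABLES (axiomatised families), which cannot instantiate `KMV2000.MomentAsymptotics`
(REF-E (E5)); nothing proves K_A (stmt-Parity-20007), K_B, any moment asymptotic or any exceptional-zero theorem (no
Landau–Siegel / Siegel-zero exclusion, no Theorem 1–2 of arXiv:2211.02515, no repaired Margin232); typed ≠ proved.
-/

noncomputable section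

open scoped Real
open Finset Complex Polynomial CongruenceSubgroup
open Literature.NumberTheory.LFunctions
open Literature.NumberTheory.LFunctions.KMV2000
open Literature.NumberTheory.EllipticCurves.ModularForms

namespace Summit.Parity.GeneralizedHardyLittlewood.Theorems.PrimeLevelFamEdgeIdeaDeltas.Negation

universe u

variable {α : Type u}
variable {β : ℕ → Type u}

/-! ## §3. The ROGUE EXTENSION `T ⊕ {f*}` and its exact decomposition lemmas -/

/-- Harmonic weight of the rogue form: `w* = q^{-3/2}` (the tolerance edge of `kmv2000_eq4` and
of the Petersson bound at `(m,n) = (1,1)`). -/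
def rogueW (q : ℕ) : ℝ := (q : ℝ) ^ (-(3 / 2 : ℝ))

/-- Hecke table of the rogue form: `λ*(m) = μ(m) ψ(m)` (so `|λ*(m)| ≤ 2^{ω(m)} = d(m)` on
squarefrees: a Deligne-compatible table; Satake-free). -/
def rogueLam (m : ℕ) : ℂ := (((ArithmeticFunction.moebius m : ℝ) * psi m : ℝ) : ℂ)

/-- Central jet of the rogue form: `Λ*(½) = q̂^{1/2} · √q` (central value `L* = √q`, the
tolerance edge of Bettin's first moment at `m = 1` against `w*`), all higher jets `0`. -/
def rogueJet (q : ℕ) [NeZero q] (j : ℕ) : ℂ :=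
  if j = 0 then ((Real.sqrt (qhat q) * Real.sqrt q : ℝ) : ℂ) else 0

/-- THE ROGUE EXTENSION of a table: one more index `none` carrying `(w*, λ*, Λ*)`. -/
def rogue (q : ℕ) [NeZero q] (T : FamTable α) : FamTable (Option α) where
  S := Finset.insertNone T.S
  w := fun o ↦ o.elim (rogueW q) T.w
  lam := fun o ↦ o.elim rogueLam T.lam
  jet := fun o ↦ o.elim (rogueJet q) T.jet

/-- The rogue extension along the levels. -/
def rogueTables (𝓕 : Tables β) : Tables (fun q ↦ Option (β q)) := fun q _ ↦ rogue q (𝓕 q)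

/-- `rogueTables 𝓕 q` unfolds to `rogue q (𝓕 q)`. -/
@[simp] theorem rogueTables_apply (𝓕 : Tables β) (q : ℕ) [NeZero q] :
    rogueTables 𝓕 q = rogue q (𝓕 q) := rfl

section RogueLemmas

variable (q : ℕ) [NeZero q] (T : FamTable α)

/-- The rogue's harmonic average = the rogue term + the old average. -/
theorem rogue_hsum (g : Option α → ℂ) :
    (rogue q T).hsum g = (rogueW q : ℂ) * g none + T.hsum (fun f ↦ g (some f)) := by
  unfold FamTable.hsum rogue
  rw [Finset.sum_insertNone]
  rfl

/-- The rogue's mass = `w*` + the old mass. -/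
theorem rogue_mass : (rogue q T).mass = rogueW q + T.mass := by
  unfold FamTable.mass rogue
  rw [Finset.sum_insertNone]
  rfl

/-- The rogue extension keeps non-negative weights. -/
theorem rogue_nonnegWeights (hT : T.NonnegWeights) : (rogue q T).NonnegWeights := by
  intro o ho
  unfold rogue at ho ⊢
  rcases o with _ | f
  · simp only [Option.elim]
    unfold rogueW
    positivity
  · simp only [Option.elim]
    exact hT f (Finset.some_mem_insertNone.mp ho)

/-- Old forms keep their mollifier in the rogue extension. -/
theorem mollF_rogue_some (P : ℝ[X]) (M : ℝ) (f : α) :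
    mollF (rogue q T) P M (some f) = mollF T P M f := rfl

/-- Old forms keep their `Q̃` in the rogue extension. -/
theorem QtildeF_rogue_some (Q : ℝ[X]) (f : α) :
    QtildeF q (rogue q T) Q (some f) = QtildeF q T Q f := rfl

/-- Old forms keep their central value in the rogue extension. -/
theorem centralF_rogue_some (f : α) : centralF q (rogue q T) (some f) = centralF q T f := rfl

/-- The rogue mollifier sum `S_P(M) := Σ_{m ≤ M} μ(m)² m^{-1/2} P(log(M/m)/log M)` (real). -/
def rogueMollSum (P : ℝ[X]) (M : ℝ) : ℝ :=
  ∑ m ∈ Icc 1 ⌊M⌋₊, ((ArithmeticFunction.moebius m : ℝ) ^ 2 *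
    ((m : ℝ) ^ (-(1 / 2 : ℝ)) * P.eval (Real.log (M / m) / Real.log M)))

/-- `M_P(f*) = S_P(M)`: the `ψ`'s cancel and `μ·μ = μ²`. -/
theorem mollF_rogue_none (P : ℝ[X]) (M : ℝ) :
    mollF (rogue q T) P M none = ((rogueMollSum P M : ℝ) : ℂ) := by
  unfold mollF rogueMollSum rogue
  simp only [Option.elim]
  push_cast
  refine Finset.sum_congr rfl fun m _ ↦ ?_
  unfold rogueLam
  have hψ : (psi m : ℂ) ≠ 0 := by
    exact_mod_cast (lt_of_lt_of_le one_pos (one_le_psi m)).ne'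
  push_cast
  field_simp

/-- `Q̃Λ*(½) = a₀ · Λ*(½)` (all higher rogue jets vanish). -/
theorem QtildeF_rogue_none (Q : ℝ[X]) :
    QtildeF q (rogue q T) Q none = (Q.coeff 0 : ℂ) * rogueJet q 0 := by
  unfold QtildeF rogue
  simp only [Option.elim]
  rw [Finset.sum_eq_single 0]
  · simp [rogueJet]
  · intro j _ hj
    simp [rogueJet, hj]
  · intro h
    simp at h

/-- `Q̃` at `Q = 1` is the jet of order `0`. -/
theorem QtildeF_one (T' : FamTable α) (f : α) : QtildeF q T' 1 f = T'.jet f 0 := by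
  unfold QtildeF
  simp

/-- The rogue's central value `Λ*(½) = q̂^{1/2}√q`. -/
theorem rogueJet_zero : rogueJet q 0 = ((Real.sqrt (qhat q) * Real.sqrt q : ℝ) : ℂ) := by
  simp [rogueJet]

/-- EXACT DECOMPOSITION of the second display: `Q^h(rogue T) = w* ‖Q̃Λ* · M*_P‖² + Q^h(T)`. -/
theorem QhF_rogue (P Q : ℝ[X]) (M : ℝ) :
    QhF q (rogue q T) P Q M =
      (rogueW q : ℂ) * (((‖(Q.coeff 0 : ℂ) * rogueJet q 0 * ((rogueMollSum P M : ℝ) : ℂ)‖ ^ 2 : ℝ) : ℂ))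
        + QhF q T P Q M := by
  unfold QhF
  rw [rogue_hsum]
  congr 2
  · rw [QtildeF_rogue_none, mollF_rogue_none, mul_assoc]
  
/-- EXACT DECOMPOSITION of the first display. -/
theorem LhF_rogue (P Q : ℝ[X]) (M : ℝ) :
    LhF q (rogue q T) P Q M =
      (rogueW q : ℂ) * ((Q.coeff 0 : ℂ) * rogueJet q 0 * ((rogueMollSum P M : ℝ) : ℂ))
        + LhF q T P Q M := by
  unfold LhF
  rw [rogue_hsum, QtildeF_rogue_none, mollF_rogue_none]
  rfl

/-- EXACT DECOMPOSITION of the Petersson pair sums. -/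
theorem petF_rogue (m n : ℕ) :
    petF (rogue q T) m n = (rogueW q : ℂ) * (rogueLam m * rogueLam n) + petF T m n := by
  unfold petF
  rw [rogue_hsum]
  rfl

/-- The rogue central value is `L* = √q`. -/
theorem centralF_rogue_none : centralF q (rogue q T) none = ((Real.sqrt q : ℝ) : ℂ) := by
  unfold centralF rogue
  simp only [Option.elim]
  rw [rogueJet_zero]
  have hq : 0 < qhat q := qhat_pos (NeZero.one_le)
  have hcpow : (((qhat q : ℝ) : ℂ) ^ (1 / 2 : ℂ)) = ((Real.sqrt (qhat q) : ℝ) : ℂ) := by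
    rw [Real.sqrt_eq_rpow, Complex.ofReal_cpow hq.le]
    norm_num
  rw [hcpow]
  have hne : ((Real.sqrt (qhat q) : ℝ) : ℂ) ≠ 0 := by
    exact_mod_cast (Real.sqrt_pos.mpr hq).ne'
  push_cast
  field_simp

/-- EXACT DECOMPOSITION of Bettin's twisted first moment. -/
theorem twistedFirstF_rogue (m : ℕ) :
    twistedFirstF q (rogue q T) m =
      (rogueW q : ℂ) * (rogueLam m * ((Real.sqrt q : ℝ) : ℂ)) + twistedFirstF q T m := by
  unfold twistedFirstF
  rw [rogue_hsum, centralF_rogue_none]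
  rfl

/-- `Re Q^h(T) ≥ 0` for non-negative weights. -/
theorem re_QhF_nonneg (hT : T.NonnegWeights) (P Q : ℝ[X]) (M : ℝ) : 0 ≤ (QhF q T P Q M).re :=
  T.re_hsum_ofReal_nonneg hT fun _ _ ↦ sq_nonneg _

/-- The rogue extension RAISES `Re Q^h`: every floor on `Re Q^h` (e.g. `re_QhPQ_one_floor`) is kept. -/
theorem re_QhF_le_rogue (P Q : ℝ[X]) (M : ℝ) :
    (QhF q T P Q M).re ≤ (QhF q (rogue q T) P Q M).re := by
  rw [QhF_rogue, Complex.add_re]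
  have : 0 ≤ ((rogueW q : ℂ) *
      (((‖(Q.coeff 0 : ℂ) * rogueJet q 0 * ((rogueMollSum P M : ℝ) : ℂ)‖ ^ 2 : ℝ) : ℂ))).re := by
    rw [← Complex.ofReal_mul, Complex.ofReal_re]
    unfold rogueW
    positivity
  linarith

end RogueLemmas


/-! ## §4. The elementary squarefree count `N ≤ 3 · #{m ≤ N : μ²(m) = 1}` -/

/-- `Σ_{2 ≤ d ≤ N} d⁻² ≤ 2/3` (telescoping). -/
theorem sum_Icc_inv_sq_le (N : ℕ) : ∑ d ∈ Icc 2 N, ((d : ℝ) ^ 2)⁻¹ ≤ 2 / 3 := by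
  rcases Nat.eq_zero_or_pos N with rfl | hN
  · norm_num
  · -- telescoping majorant `1/d² ≤ 2/(2d-1) - 2/(2d+1)`
    have key : ∀ n : ℕ, 1 ≤ n → ∑ d ∈ Icc 2 n, ((d : ℝ) ^ 2)⁻¹ ≤ 2 / 3 - 2 / (2 * n + 1) := by
      intro n hn
      induction n, hn using Nat.le_induction with
      | base => norm_num
      | succ n hn ih =>
        rw [Finset.sum_Icc_succ_top (by omega)]
        have hstep : (0 : ℝ) ≤ 2 / (2 * n + 1) - 2 / (2 * (n + 1 : ℕ) + 1) - (((n + 1 : ℕ) : ℝ) ^ 2)⁻¹ := by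
          have h : (2 : ℝ) / (2 * n + 1) - 2 / (2 * (n + 1 : ℕ) + 1) - (((n + 1 : ℕ) : ℝ) ^ 2)⁻¹ =
              1 / ((2 * n + 1) * (2 * n + 3) * ((n : ℝ) + 1) ^ 2) := by
            push_cast
            field_simp
            ring
          rw [h]
          positivity
        linarith
    have := key N hN
    have h2 : (0 : ℝ) ≤ 2 / (2 * N + 1) := by positivity
    linarith

/-- `Icc 1 N = Ioc 0 N` in `ℕ` (private copy of the tree's `VonKochConverse.Icc_one_eq_Ioc_zero`). -/
private theorem Icc_one_eq_Ioc_zero (N : ℕ) : Finset.Icc 1 N = Finset.Ioc 0 N := by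
  ext m
  simp only [Finset.mem_Icc, Finset.mem_Ioc]
  omega

/-- The non-squarefree `m ≤ N` are covered by the multiples of `d²`, `2 ≤ d ≤ N`. -/
theorem card_filter_not_squarefree_le (N : ℕ) :
    (((Icc 1 N).filter (fun m ↦ ¬ Squarefree m)).card : ℝ) ≤ 2 / 3 * N := by
  classical
  have hsub : (Icc 1 N).filter (fun m ↦ ¬ Squarefree m) ⊆
      (Icc 2 N).biUnion (fun d ↦ (Icc 1 N).filter (fun m ↦ d * d ∣ m)) := by
    intro m hm
    rw [Finset.mem_filter] at hm
    obtain ⟨hm, hnsq⟩ := hm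
    rw [Finset.mem_Icc] at hm
    unfold Squarefree at hnsq
    push Not at hnsq
    obtain ⟨x, hx, hxu⟩ := hnsq
    rw [Nat.isUnit_iff] at hxu
    have hx0 : x ≠ 0 := by
      rintro rfl
      simp at hx
      omega
    have hx2 : 2 ≤ x := by omega
    have hxN : x ≤ N := by
      have : x * x ≤ m := Nat.le_of_dvd (by omega) hx
      nlinarith
    rw [Finset.mem_biUnion]
    exact ⟨x, Finset.mem_Icc.mpr ⟨hx2, hxN⟩, Finset.mem_filter.mpr ⟨Finset.mem_Icc.mpr hm, hx⟩⟩
  have hcard : ((Icc 1 N).filter (fun m ↦ ¬ Squarefree m)).card ≤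
      ∑ d ∈ Icc 2 N, N / (d * d) := by
    refine (Finset.card_le_card hsub).trans ((Finset.card_biUnion_le).trans ?_)
    refine Finset.sum_le_sum fun d _ ↦ ?_
    rw [Icc_one_eq_Ioc_zero, Nat.Ioc_filter_dvd_card_eq_div]
  calc (((Icc 1 N).filter (fun m ↦ ¬ Squarefree m)).card : ℝ)
      ≤ ((∑ d ∈ Icc 2 N, N / (d * d) : ℕ) : ℝ) := by exact_mod_cast hcard
    _ = ∑ d ∈ Icc 2 N, (((N / (d * d) : ℕ)) : ℝ) := by push_cast; rfl
    _ ≤ ∑ d ∈ Icc 2 N, (N : ℝ) * ((d : ℝ) ^ 2)⁻¹ := by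
        refine Finset.sum_le_sum fun d hd ↦ ?_
        refine (Nat.cast_div_le).trans ?_
        rw [div_eq_mul_inv]
        push_cast
        rw [sq]
    _ = (N : ℝ) * ∑ d ∈ Icc 2 N, ((d : ℝ) ^ 2)⁻¹ := by rw [Finset.mul_sum]
    _ ≤ (N : ℝ) * (2 / 3) := by
        exact mul_le_mul_of_nonneg_left (sum_Icc_inv_sq_le N) (Nat.cast_nonneg N)
    _ = 2 / 3 * N := by ring

/-- SQUAREFREE COUNT: `N ≤ 3 · #{1 ≤ m ≤ N : m squarefree}`. -/
theorem le_three_mul_card_squarefree (N : ℕ) :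
    (N : ℝ) ≤ 3 * (((Icc 1 N).filter Squarefree).card : ℝ) := by
  classical
  have hsplit := Finset.card_filter_add_card_filter_not
    (s := Icc 1 N) (p := fun m : ℕ ↦ Squarefree m)
  have hN : ((Icc 1 N).card : ℝ) = N := by simp
  have hcast : (((Icc 1 N).filter Squarefree).card : ℝ) +
      (((Icc 1 N).filter (fun m ↦ ¬ Squarefree m)).card : ℝ) = N := by
    rw [← hN]
    exact_mod_cast hsplit
  have := card_filter_not_squarefree_le N
  linarith


end Summit.Parity.GeneralizedHardyLittlewood.Theorems.PrimeLevelFamEdgeIdeaDeltas.Negation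

end
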